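import Summits.Ventures.PercRepro.CoreSixPlanes
import Summits.Ventures.PercRepro.CoreSixSmall

/-!
# PercRepro — the corank-`6` core cell `p = 9` (p2, gen 12)

`n = |E| = 15`. With the plane count of `CoreSixPlanes` (`#{sets of rank ≤ 3 with ≥ 5 points} ≤ s₄ + 29` at nullity
`≤ 6`, rank `≥ 7`) in place of the `29·s₄/7` of `CoreSixSmall`, the method of `CoreSixSmall` closes the cell:
`ν(S₀) ≤ 5` (`s₃ ≤ 25`, `s₄ ≤ 70`): ratio `0.80`; `S₀ = E` (series classes, the count with the exact number of classes):
54 class-size vectors by kernel evaluation, worst `0.90` (all classes singletons: `s₃ ≤ 36`, `s₄ ≤ 107`).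

* `cellOK6b`, `cellOK6b_spec`, **`rls_of_cellOK6b`**; **`c025_core_six_nine`**;
* `SmallCoreCellsEight`, `smallCoreCellsSeven_of_eight`, **`c025_three_of_smallCoreCellsEight`**.
Imports `CoreSixPlanes`, `CoreSixSmall`. Axioms: standard.
-/

namespace PercRepro
namespace CoreFour

open Finset Set

variable {α : Type} {M : Matroid α}

/-- The corank-`6` cell with `A := s₄ + 29`. -/
def cellOK6b (n s₃ s₄ : ℕ) : Bool :=
  let p := n - 6
  let phiNum := 2 ^ (p + 3) - 2 * ∑ u ∈ range 4, CoreRegimes.chooseF (p + 3) u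
  let phiDen := CoreRegimes.chooseF (p + 3) 3
  let U := CoreRegimes.chooseF n 3 + (s₃ * (n - 3) + s₄) + (s₄ + 29)
  let R := (∑ j ∈ range 4, CoreRegimes.chooseF n j) + (s₃ * (n - 3) + s₄) + (s₄ + 29)
  let S := ∑ j ∈ range 7, CoreRegimes.chooseF n j
  decide (phiNum * U + phiDen * (R + S) ≤ phiDen * 2 ^ n)

/-- What `cellOK6b n s₃ s₄ = true` says, as an inequality in `ℕ` (with `A = s₄ + 29`). -/
theorem cellOK6b_spec {n s₃ s₄ : ℕ} (h : cellOK6b n s₃ s₄ = true) :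
    (2 ^ (n - 6 + 3) - 2 * ∑ u ∈ range 4, Nat.choose (n - 6 + 3) u) *
        (n.choose 3 + (s₃ * (n - 3) + s₄) + (s₄ + 29)) +
      Nat.choose (n - 6 + 3) 3 * (((∑ j ∈ range 4, n.choose j) + (s₃ * (n - 3) + s₄) + (s₄ + 29)) +
        ∑ j ∈ range 7, n.choose j) ≤ Nat.choose (n - 6 + 3) 3 * 2 ^ n := by
  unfold cellOK6b at h
  simp only [CoreRegimes.chooseF_eq] at h
  exact of_decide_eq_true h

/-- **A kernel-evaluated cell gives C-025 at `(p, 3)`** on the coloop-free core with (C1), (C2), `p ≥ 9`, `|E| = p + 6`. -/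
theorem rls_of_cellOK6b (M : Matroid α) [M.Finite] (p : ℕ) (hp : 9 ≤ p)
    (hs : ∀ e ∈ M.E, ∀ f ∈ M.E, e ≠ f → M.eRk {e, f} = 2)
    (hC1 : ∀ L ⊆ M.E, M.eRk L = 2 → L.ncard ≤ 3) (hC2 : ∀ P ⊆ M.E, M.eRk P = 3 → P.ncard ≤ 7)
    (hcoloop : ∀ e, ¬ M.IsColoop e) (hrank : M.eRank = (p : ℕ∞)) (hE : M.E.ncard = p + 6)
    {s₃ s₄ : ℕ} (hs₃ : (PercRepro.Matroid.circuitsEq M 3).ncard ≤ s₃)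
    (hs₄ : (PercRepro.Matroid.circuitsEq M 4).ncard ≤ s₄)
    (hcell : cellOK6b (p + 6) s₃ s₄ = true) : ThmN.RLS M p 3 := by
  classical
  have hEcard : M.ground_finite.toFinset.card = p + 6 := by
    rw [← hE, Set.ncard_eq_toFinset_card _ M.ground_finite]
  have hd : M.E.encard = M.eRank + 6 := by
    rw [hrank, ← M.ground_finite.cast_ncard_eq, hE]; push_cast; rfl
  have hrank2 : 2 ≤ M.eRank := by rw [hrank]; exact_mod_cast (show 2 ≤ p by omega)
  have h4 : {X : Set α | X ⊆ M.E ∧ X.ncard = 4 ∧ M.eRk X ≤ 3}.ncard ≤ s₃ * (p + 6 - 3) + s₄ := by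
    have h := ncard_four_sets_le hs hrank2
    rw [hE] at h
    have h' : (PercRepro.Matroid.circuitsEq M 3).ncard * (p + 6 - 3) ≤ s₃ * (p + 6 - 3) :=
      Nat.mul_le_mul_right _ hs₃
    omega
  have hbig : {X : Set α | X ⊆ M.E ∧ M.eRk X ≤ 3 ∧ 5 ≤ X.ncard}.ncard ≤ s₄ + 29 := by
    have h := ncard_big_sets_le_six hs hC1 hC2 hcoloop hd (by norm_num) hrank (by omega)
    omega
  have hU : Matroid.topCount M p 3 ≤ (p + 6).choose 3 + (s₃ * (p + 6 - 3) + s₄) + (s₄ + 29) := by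
    have h := topCount_le_general (M := M) p
    rw [hE] at h
    omega
  have hR : {X : Set α | X ⊆ M.E ∧ M.eRk X ≤ 3}.ncard ≤
      (∑ j ∈ range 4, (p + 6).choose j) + (s₃ * (p + 6 - 3) + s₄) + (s₄ + 29) := by
    have h := ncard_eRk_le_three_le_general (M := M)
    rw [hE] at h
    omega
  have hS : {X : Set α | X ⊆ M.E ∧ M.eRk X = M.eRank}.ncard ≤ ∑ j ∈ range 7, (p + 6).choose j := by
    have h := PercRepro.Matroid.ncard_spanning_le (M := M) (d := 6) hd
    rw [hEcard] at h
    exact h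
  have hY : 2 ^ (p + 6) ≤ Matroid.midCount M p 3 + {X : Set α | X ⊆ M.E ∧ M.eRk X ≤ 3}.ncard +
      {X : Set α | X ⊆ M.E ∧ M.eRk X = M.eRank}.ncard := by
    have h := PercRepro.Matroid.two_pow_le_midCount_add (M := M) p 3 hrank
    rw [hEcard] at h
    exact h
  have hcell' := cellOK6b_spec hcell
  rw [Nat.add_sub_cancel] at hcell'
  obtain ⟨phiNum, hphiNum⟩ : ∃ x, x = 2 ^ (p + 3) - 2 * ∑ u ∈ range 4, Nat.choose (p + 3) u := ⟨_, rfl⟩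
  obtain ⟨phiDen, hphiDen⟩ : ∃ x, x = Nat.choose (p + 3) 3 := ⟨_, rfl⟩
  obtain ⟨U, hU_def⟩ : ∃ x, x = (p + 6).choose 3 + (s₃ * (p + 6 - 3) + s₄) + (s₄ + 29) := ⟨_, rfl⟩
  obtain ⟨R, hR_def⟩ : ∃ x, x = (∑ j ∈ range 4, (p + 6).choose j) + (s₃ * (p + 6 - 3) + s₄) + (s₄ + 29) :=
    ⟨_, rfl⟩
  obtain ⟨S, hS_def⟩ : ∃ x, x = ∑ j ∈ range 7, (p + 6).choose j := ⟨_, rfl⟩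
  rw [← hphiNum, ← hphiDen, ← hU_def, ← hR_def, ← hS_def] at hcell'
  rw [← hU_def] at hU
  rw [← hR_def] at hR
  rw [← hS_def] at hS
  have hUq : (Matroid.topCount M p 3 : ℚ) ≤ (U : ℚ) := by exact_mod_cast hU
  have hRq : ({X : Set α | X ⊆ M.E ∧ M.eRk X ≤ 3}.ncard : ℚ) ≤ (R : ℚ) := by exact_mod_cast hR
  have hSq : ({X : Set α | X ⊆ M.E ∧ M.eRk X = M.eRank}.ncard : ℚ) ≤ (S : ℚ) := by exact_mod_cast hS
  have hYq : ((2 : ℕ) ^ (p + 6) : ℚ) ≤ (Matroid.midCount M p 3 : ℚ) +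
      ({X : Set α | X ⊆ M.E ∧ M.eRk X ≤ 3}.ncard : ℚ) +
      ({X : Set α | X ⊆ M.E ∧ M.eRk X = M.eRank}.ncard : ℚ) := by exact_mod_cast hY
  have hcellq : (phiNum : ℚ) * (U : ℚ) + (phiDen : ℚ) * ((R : ℚ) + (S : ℚ)) ≤
      (phiDen : ℚ) * ((2 : ℕ) ^ (p + 6) : ℚ) := by exact_mod_cast hcell'
  have hsub : 2 * ∑ u ∈ range 4, Nat.choose (p + 3) u ≤ 2 ^ (p + 3) := by
    have := CoreRegimes.sum_Ioo_choose_add p (by omega); omega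
  have hphi : phiK p 3 * (phiDen : ℚ) = (phiNum : ℚ) := by
    rw [hphiNum, Nat.cast_sub hsub, hphiDen]
    push_cast
    exact CoreRegimes.phiK_three_mul_choose_eq p (by omega)
  have hDpos : (0 : ℚ) < (phiDen : ℚ) := by
    rw [hphiDen]; exact_mod_cast Nat.choose_pos (by omega)
  have hNnn : (0 : ℚ) ≤ (phiNum : ℚ) := by positivity
  have h1 : (phiNum : ℚ) * (Matroid.topCount M p 3 : ℚ) ≤ (phiNum : ℚ) * (U : ℚ) :=
    mul_le_mul_of_nonneg_left hUq hNnn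
  have h2 : (phiDen : ℚ) * ((2 : ℕ) ^ (p + 6) : ℚ) ≤
      (phiDen : ℚ) * ((Matroid.midCount M p 3 : ℚ) + (R : ℚ) + (S : ℚ)) :=
    mul_le_mul_of_nonneg_left (by linarith) hDpos.le
  have hkey : (phiNum : ℚ) * (Matroid.topCount M p 3 : ℚ) ≤ (phiDen : ℚ) * (Matroid.midCount M p 3 : ℚ) := by
    have h2' := h2
    rw [mul_add, mul_add] at h2'
    have hc' := hcellq
    rw [mul_add] at hc'
    have hUmid : (phiNum : ℚ) * (U : ℚ) ≤ (phiDen : ℚ) * (Matroid.midCount M p 3 : ℚ) := by linarith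
    linarith
  rw [ThmN.RLS_iff]
  rw [← hphi] at hkey
  have : phiK p 3 * (Matroid.topCount M p 3 : ℚ) * (phiDen : ℚ) ≤ (Matroid.midCount M p 3 : ℚ) * (phiDen : ℚ) := by
    calc phiK p 3 * (Matroid.topCount M p 3 : ℚ) * (phiDen : ℚ)
        = phiK p 3 * (phiDen : ℚ) * (Matroid.topCount M p 3 : ℚ) := by ring
      _ ≤ (phiDen : ℚ) * (Matroid.midCount M p 3 : ℚ) := hkey
      _ = (Matroid.midCount M p 3 : ℚ) * (phiDen : ℚ) := by ring
  exact le_of_mul_le_mul_right this hDpos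

/-- The cell `n = 15` with `s₃ = 25`, `s₄ = 70`. -/
theorem table_sparse6b : cellOK6b 15 25 70 = true := by
  decide +kernel

/-- Every class-size vector of the all-dense case at `n = 15`. -/
theorem table_dense6b_15 : ∀ σ < 16, ∀ t₂ < 8, ∀ t₃ < 6, ∀ t₄ < 4, σ + 2 * t₂ + 3 * t₃ + 4 * t₄ = 15 →
    cellOK6b 15 (bound3six σ t₂ t₃ t₄) (bound4six σ t₂ t₃ t₄) = true := by
  decide +kernel

/-- **C-025 at `(9, 3)` on the coloop-free core at corank `6`.** -/
theorem c025_core_six_nine (M : Matroid α) [M.Finite]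
    (hs : ∀ e ∈ M.E, ∀ f ∈ M.E, e ≠ f → M.eRk {e, f} = 2) (hcoloop : ∀ e, ¬ M.IsColoop e)
    (hfree : ∀ e ∈ M.E, ∃ A ⊆ M.E \ {e}, e ∉ M.closure A ∧ e ∉ M.closure ((M.E \ {e}) \ A))
    (hrank : M.eRank = ((9 : ℕ) : ℕ∞)) (hE : M.E.ncard = 9 + 6) : ThmN.RLS M 9 3 := by
  classical
  have hC1 : ∀ L ⊆ M.E, M.eRk L = 2 → L.ncard ≤ 3 :=
    fun L hL hr => ThmN.ncard_le_three_of_eRk_two M hs hfree hL hr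
  have hC2 : ∀ P ⊆ M.E, M.eRk P = 3 → P.ncard ≤ 7 :=
    fun P hP hr => ThmN.ncard_le_seven_of_eRk_three M hs hfree hP hr
  have hd : M.E.encard = M.eRank + 6 := by
    rw [hrank, ← M.ground_finite.cast_ncard_eq, hE]; push_cast; rfl
  set S₀ := ⋃₀ PercRepro.Matroid.circuitsLE M 4 with hS₀def
  have hS₀E : S₀ ⊆ M.E := sUnion_circuitsLE_subset_ground M 4
  have hS₀fin : S₀.Finite := M.ground_finite.subset hS₀E
  obtain ⟨r, hr⟩ := exists_eRk_eq_nat (M := M) S₀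
  have hrle : r ≤ S₀.ncard := by
    have := M.eRk_le_encard S₀
    rw [hr, ← hS₀fin.cast_ncard_eq] at this
    exact_mod_cast this
  have hd' : S₀.encard = M.eRk S₀ + ((S₀.ncard - r : ℕ) : ℕ∞) := by
    rw [hr, ← hS₀fin.cast_ncard_eq]
    have : S₀.ncard = r + (S₀.ncard - r) := by omega
    conv_lhs => rw [this]
    push_cast; rfl
  have hmono := encard_le_eRk_add_of_ground hS₀E hd
  rw [hd'] at hmono
  have hle6 : S₀.ncard - r ≤ 6 := by
    have h := (WithTop.add_le_add_iff_left (by rw [hr]; exact WithTop.natCast_ne_top r)).1 hmono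
    have h' : ((S₀.ncard - r : ℕ) : ℕ∞) ≤ ((6 : ℕ) : ℕ∞) := h
    exact_mod_cast h'
  rcases Nat.lt_or_ge (S₀.ncard - r) 6 with hlt | hge
  · -- case A
    have hS20 : S₀.ncard ≤ 20 := by
      have := Set.ncard_le_ncard hS₀E M.ground_finite; omega
    have hs₃ : (PercRepro.Matroid.circuitsEq M 3).ncard ≤ 25 := by
      have h := ThmN.core_ncard_triangles_subset_le_sq M hs hfree hS₀E hd'
      have hsub : PercRepro.Matroid.circuitsEq M 3 ⊆
          {C : Set α | M.IsCircuit C ∧ C.ncard = 3 ∧ C ⊆ S₀} := by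
        intro C hC
        exact ⟨hC.1, hC.2, Set.subset_sUnion_of_mem (PercRepro.Matroid.circuitsEq_subset_circuitsLE (by norm_num) hC)⟩
      have hfin : {C : Set α | M.IsCircuit C ∧ C.ncard = 3 ∧ C ⊆ S₀}.Finite :=
        M.ground_finite.finite_subsets.subset (fun C hC => hC.1.subset_ground)
      calc (PercRepro.Matroid.circuitsEq M 3).ncard ≤ _ := Set.ncard_le_ncard hsub hfin
        _ ≤ (S₀.ncard - r) * (S₀.ncard - r) := h
        _ ≤ 5 * 5 := Nat.mul_le_mul (show S₀.ncard - r ≤ 5 by omega) (show S₀.ncard - r ≤ 5 by omega)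
        _ = 25 := by norm_num
    have hs₄ : (PercRepro.Matroid.circuitsEq M 4).ncard ≤ 70 :=
      PercRepro.Matroid.ncard_isCircuit_four_le_of_subset_nullity_le_five M hS₀E
        (fun C hC h4 => subset_sUnion_of_mem_circuitsEq_four ⟨hC, h4⟩) hS20
        (by rw [hd']; gcongr; exact_mod_cast (show S₀.ncard - r ≤ 5 by omega))
    exact rls_of_cellOK6b M 9 (by norm_num) hs hC1 hC2 hcoloop hrank hE hs₃ hs₄ table_sparse6b
  · -- case B
    have h6 : S₀.ncard - r = 6 := by omega
    rw [h6] at hd'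
    have hS₀ : S₀ = M.E := eq_ground_of_encard_eq_eRk_add hcoloop hS₀E hd hd'
    have hν : M✶.eRank = 6 := by
      have h := Matroid.eRank_add_eRank_dual M
      rw [hd, hrank] at h
      exact WithTop.add_left_cancel (WithTop.natCast_ne_top 9) h
    have hs36 : (PercRepro.Matroid.circuitsEq M 3).ncard ≤ 36 := by
      have h := ThmN.ncard_triangles_le_sq M hC1 hd
      exact h
    obtain ⟨R, hR⟩ := exists_isReps M
    have hRfin : R.Finite := M.ground_finite.subset hR.subset
    set Rf := hRfin.toFinset with hRf
    set a : α → ℕ := fun r => (M✶.closure {r}).ncard with ha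
    have hRc : R.ncard = Rf.card := Set.ncard_eq_toFinset_card _ _
    have h1 : ∀ r ∈ Rf, 1 ≤ a r := by
      intro r hr
      rw [hRf, Set.Finite.mem_toFinset] at hr
      have hfin := cls_finite (M := M) r
      exact Nat.one_le_iff_ne_zero.2 (fun h0 => by
        have := (Set.ncard_eq_zero hfin).1 h0
        exact (Set.eq_empty_iff_forall_notMem.1 this r) (mem_cls_self hR hr))
    have h4 : ∀ r ∈ Rf, a r ≤ 4 := by
      intro r hr
      rw [hRf, Set.Finite.mem_toFinset] at hr
      have hrE : r ∈ ⋃₀ PercRepro.Matroid.circuitsLE M 4 := by rw [← hS₀def, hS₀]; exact hR.subset hr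
      obtain ⟨C, hC, hrC⟩ := Set.mem_sUnion.1 hrE
      have hsub := closure_dual_singleton_subset_of_mem_isCircuit hcoloop hC.1 hrC
      have hCfin : C.Finite := M.ground_finite.subset hC.1.subset_ground
      have hC4 : C.ncard ≤ 4 := by
        have := hC.2
        rw [← hCfin.cast_ncard_eq] at this
        exact_mod_cast this
      exact (Set.ncard_le_ncard hsub hCfin).trans hC4
    set σ := (Rf.filter (fun r => a r = 1)).card with hσ
    set t₂ := (Rf.filter (fun r => a r = 2)).card with ht₂
    set t₃ := (Rf.filter (fun r => a r = 3)).card with ht₃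
    set t₄ := (Rf.filter (fun r => a r = 4)).card with ht₄
    have hn : 9 + 6 = σ + 2 * t₂ + 3 * t₃ + 4 * t₄ := by
      rw [← hE, ncard_ground_eq_sum hcoloop hR hRfin, ← hRf]
      exact sum_eq_of_le_four Rf a h1 h4
    have hc : Rf.card = σ + t₂ + t₃ + t₄ := card_eq_of_le_four Rf a h1 h4
    have hlm3 : (PercRepro.Matroid.circuitsEq M 3).ncard ≤ lm6 (σ + t₂ + t₃ + t₄) 3 := by
      have h := PercRepro.Matroid.ncard_isCircuit_mul_choose_le M hR.subset hR.nonloop hR.cover hR.inj hν 3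
      rw [hRc, hc] at h
      exact le_lm6_of_mul_le h
    have hlm4 : (PercRepro.Matroid.circuitsEq M 4).ncard ≤ lm6 (σ + t₂ + t₃ + t₄) 4 := by
      have h := PercRepro.Matroid.ncard_isCircuit_mul_choose_le M hR.subset hR.nonloop hR.cover hR.inj hν 4
      rw [hRc, hc] at h
      exact le_lm6_of_mul_le h
    have hw3 : (PercRepro.Matroid.circuitsEq M 3).ncard ≤ σ.choose 3 + σ * t₂ + t₃ :=
      (ncard_circuitsEq_le_card_weight hcoloop hR hRfin 3).trans (card_weight_three_le Rf a h1)
    have hw4 : (PercRepro.Matroid.circuitsEq M 4).ncard ≤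
        σ.choose 4 + σ.choose 2 * t₂ + t₂.choose 2 + σ * t₃ + t₄ :=
      (ncard_circuitsEq_le_card_weight hcoloop hR hRfin 4).trans (card_weight_four_le Rf a h1)
    have hs₃ : (PercRepro.Matroid.circuitsEq M 3).ncard ≤ bound3six σ t₂ t₃ t₄ :=
      le_min hs36 (le_min hlm3 hw3)
    have hs₄ : (PercRepro.Matroid.circuitsEq M 4).ncard ≤ bound4six σ t₂ t₃ t₄ := le_min hlm4 hw4
    exact rls_of_cellOK6b M 9 (by norm_num) hs hC1 hC2 hcoloop hrank hE hs₃ hs₄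
      (table_dense6b_15 σ (by omega) t₂ (by omega) t₃ (by omega) t₄ (by omega) hn.symm)

/-- **The small core cells without corank `4` below `18`, corank `5` below `14`, corank `6` at `9 ≤ p ≤ 12`.** -/
def SmallCoreCellsEight : Prop :=
  ∀ {α : Type} (M : Matroid α) [M.Finite] (p : ℕ), 5 ≤ p →
    (∀ e ∈ M.E, ∀ f ∈ M.E, e ≠ f → M.eRk {e, f} = 2) → M.eRank = (p : ℕ∞) →
    (∀ e, ¬ M.IsColoop e) →
    (∀ e ∈ M.E, ∃ A ⊆ M.E \ {e}, e ∉ M.closure A ∧ e ∉ M.closure ((M.E \ {e}) \ A)) →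
    ((p = 7 ∨ p = 8) ∨
      (p ≤ 169 ∧ p + 4 ≤ M.E.ncard ∧ M.E.ncard < p + CoreRegimes.amin p ∧
        ¬ (M.E.ncard = p + 4 ∧ 100 ≤ M.E.ncard) ∧ ¬ (M.E.ncard = p + 4 ∧ 9 ≤ p ∧ p ≤ 17) ∧
        ¬ (M.E.ncard = p + 5 ∧ 9 ≤ p ∧ p ≤ 13) ∧ ¬ (M.E.ncard = p + 6 ∧ 9 ≤ p ∧ p ≤ 12))) →
    ThmN.RLS M p 3

/-- `SmallCoreCellsEight` implies `SmallCoreCellsSeven`: the `(9, 6)` cell is `c025_core_six_nine`. -/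
theorem smallCoreCellsSeven_of_eight (h : SmallCoreCellsEight) : SmallCoreCellsSeven := by
  intro α M _ p hp hs hrank hcoloop hfree hcell
  rcases hcell with h78 | ⟨hp169, hlo, hhi, h100, h4, h5, h6⟩
  · exact h M p hp hs hrank hcoloop hfree (Or.inl h78)
  · by_cases h9 : M.E.ncard = p + 6 ∧ p = 9
    · obtain ⟨hE, rfl⟩ := h9
      exact c025_core_six_nine M hs hcoloop hfree hrank hE
    · exact h M p hp hs hrank hcoloop hfree (Or.inr ⟨hp169, hlo, hhi, h100, h4, h5, fun h' => by
        rcases Nat.lt_or_ge p 10 with hlt | hge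
        · exact h9 ⟨h'.1, by omega⟩
        · exact h6 ⟨h'.1, hge, h'.2.2⟩⟩)

/-- **C-025 at `q = 3` for every finite matroid and every `p ≥ 5`, from the cells of `SmallCoreCellsEight`.** -/
theorem c025_three_of_smallCoreCellsEight (h : SmallCoreCellsEight) :
    ∀ {α : Type} (M : Matroid α) [M.Finite] (p : ℕ), 5 ≤ p → ThmN.RLS M p 3 :=
  c025_three_of_smallCoreCellsSeven (smallCoreCellsSeven_of_eight h)

end CoreFour
end PercRepro
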